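import Summits.KontsevichZagierPeriods.KontsevichZagierPeriods.Theses.SymplecticScissors
import Literature.NumberTheory.Transcendental.KZSubcalculusInvariants
import Literature.NumberTheory.Transcendental.SemialgebraicMapsProofs
import Literature.ModelTheory.ExponentialFields.TarskiSeidenbergProofs
import Summits.KontsevichZagierPeriods.KontsevichZagierPeriods.Theorems.OffTetraSectorKernel.Negative.SliceCore
import Summits.KontsevichZagierPeriods.KontsevichZagierPeriods.Theorems.SymplecticScissorsPlanarCompilerStubSignedSweepAux6

/-!
# `PlanarAreas` (stmt-KontsevichZagierPeriods-4990): negative side — IV. the first-coordinate window invariant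

The invariant behind `Rule2LoadBearing.not_withoutRule2`: `Λₑ := KZ.restrictedEval (win e)`
integrates each generator of dimension `≥ 1` over `domain ∩ {x₀ < e}` and kills dimension `0`.
It vanishes on the additivity moves (tree, `KZ.closure_add_le_ker_restrictedEval`) and on every
Newton–Leibniz move between dimensions `n + 2 → n + 1` (`restrictedEval_win_nl_succ`: the windowed
Fubini/FTC computation, the window riding on the base).  This file also prepares the `1 → 0` case:
`setIntegral_clamp` (a one-variable primitive read off at the clamped point) and the
Tarski–Seidenberg bookkeeping making the clamp `e ↦ max a₀ (min e b₀)` a `ℚ`-semialgebraic function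
when `a₀ ≤ b₀` are `ℚ`-definable (`isSemialgebraicFunOn_clamp`). -/

noncomputable section

open Set MeasureTheory MvPolynomial Filter Topology
open Literature.NumberTheory.Transcendental Literature.ModelTheory.ExponentialFields

namespace Summit.KontsevichZagierPeriods.PlanarAreas.Negative

-- (fullbuild repair 2026-08-16) `PlanarTransport` (stmt-KontsevichZagierPeriods-9849) was dropped from the route
-- file at 2026-08-16T14:16Z (items-cap autofix, moot); no declaration of this file names it, so it left the list.
open Summit.KontsevichZagierPeriods.KontsevichZagierPeriods.Theses.SymplecticScissors
  (PlanarAreas VolumeForm PlanarK0Injective GroupToAreas)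

/-! ## §3c Rule 2 is load-bearing: the change-of-variables-free sub-calculus

The FIRST-COORDINATE WINDOW invariant `Λₑ := KZ.restrictedEval (win e)` (integrate each generator of
dimension `≥ 1` over `domain ∩ {x₀ < e}`, kill dimension `0`) vanishes on the additivity moves and
on every Newton–Leibniz move between dimensions `n + 2 → n + 1` (the window does not constrain the
last coordinate), while a Newton–Leibniz move `1 → 0` contributes a SEMIALGEBRAIC function of `e`
(a clamped primitive).  Hence for any chain of rules 1a/1b/3, `e ↦ Λₑ([r] − [r'])` is semialgebraic
up to an additive constant; for the hyperbola region `R = {1<x<2, 0<y<1/x}` against its translate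
`R + (3,0)` it is `log e` on `[1,2]` — contradicting the tree's barrier fact
`noSemialgebraicPrimitive_inv_sub_two` (no semialgebraic primitive of `1/(t−2)`).  So the
sub-calculus WITHOUT rule 2 does not prove the crux: every chain for `PlanarAreas` contains a
change of variables (a coordinate swap already suffices to repair this particular pair: Cavalieri
in `y`). -/

/-- Windows on the first coordinate: `{x | x 0 < e}` in dimension `≥ 1`, `∅` in dimension `0`. -/
def win (e : ℝ) : (n : ℕ) → Set (Fin n → ℝ)
  | 0 => ∅
  | _ + 1 => {x | x 0 < e}

/-- There is no window in dimension `0`. -/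
@[simp] theorem win_zero (e : ℝ) : win e 0 = ∅ := rfl

/-- Membership in a window: the first coordinate is `< e`. -/
@[simp] theorem mem_win_succ {e : ℝ} {n : ℕ} {x : Fin (n + 1) → ℝ} : x ∈ win e (n + 1) ↔ x 0 < e :=
  Iff.rfl

/-- Windows are measurable. -/
theorem measurableSet_win (e : ℝ) : ∀ n, MeasurableSet (win e n)
  | 0 => MeasurableSet.empty
  | _ + 1 => measurableSet_lt (measurable_pi_apply 0) measurable_const

/-- Appending a last coordinate does not change the first one (dimension `≥ 1`). -/
theorem snoc_apply_zero {k : ℕ} (x : Fin (k + 1) → ℝ) (t : ℝ) :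
    (Fin.snoc x t : Fin (k + 1 + 1) → ℝ) 0 = x 0 := by
  have h : (0 : Fin (k + 1 + 1)) = Fin.castSucc (0 : Fin (k + 1)) := rfl
  rw [h]
  exact Fin.snoc_castSucc (α := fun _ => ℝ) (p := x) (x := t) (i := 0)

/-- **Newton–Leibniz moves `n + 2 → n + 1` preserve every first-coordinate window value**
(the windowed version of the soundness computation `KZ.eval_eq_zero_of_mem_newtonLeibnizRel_holds`:
Fubini along the last coordinate, the window riding on the base). -/
theorem restrictedEval_win_nl_succ (e : ℝ) {k : ℕ} (r : KZ.IntegralRep (k + 1 + 1))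
    (r' : KZ.IntegralRep (k + 1)) (a b : (Fin (k + 1) → ℝ) → ℝ) (F : (Fin (k + 1 + 1) → ℝ) → ℝ)
    (hab : ∀ x ∈ r'.domain, a x ≤ b x)
    (hdom : r.domain = {z | (Fin.init z : Fin (k + 1) → ℝ) ∈ r'.domain ∧
      a (Fin.init z) ≤ z (Fin.last (k + 1)) ∧ z (Fin.last (k + 1)) ≤ b (Fin.init z)})
    (hcont : ∀ x ∈ r'.domain, ContinuousOn (fun t : ℝ => F (Fin.snoc x t)) (Icc (a x) (b x)))
    (hderiv : ∀ x ∈ r'.domain, ∀ t ∈ Ioo (a x) (b x),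
      HasDerivAt (fun s : ℝ => F (Fin.snoc x s)) (r.integrand (Fin.snoc x t)) t)
    (hr' : ∀ x ∈ r'.domain, r'.integrand x = F (Fin.snoc x (b x)) - F (Fin.snoc x (a x))) :
    KZ.restrictedEval (win e) (KZ.of r - KZ.of r') = 0 := by
  simp only [map_sub, KZ.restrictedEval_of, sub_eq_zero]
  have hτm : MeasurableSet r'.domain := KZ.IntegralRep.measurableSet_domain_holds r'
  have hbm : MeasurableSet r.domain := KZ.IntegralRep.measurableSet_domain_holds r
  have hW2 : MeasurableSet (win e (k + 1 + 1)) := measurableSet_win e _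
  have hW1 : MeasurableSet (win e (k + 1)) := measurableSet_win e _
  set E : (Fin (k + 1 + 1) → ℝ) ≃ᵐ ℝ × (Fin (k + 1) → ℝ) :=
    MeasurableEquiv.piFinSuccAbove (fun _ => ℝ) (Fin.last (k + 1)) with hE_def
  have hE : MeasurePreserving E volume volume :=
    volume_preserving_piFinSuccAbove (fun _ => ℝ) (Fin.last (k + 1))
  have hE_symm : ∀ p : ℝ × (Fin (k + 1) → ℝ), E.symm p = Fin.snoc p.2 p.1 := fun p => by
    simp [hE_def, MeasurableEquiv.piFinSuccAbove, Fin.snocEquiv]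
  have hmem : ∀ x t, (Fin.snoc x t : Fin (k + 1 + 1) → ℝ) ∈ r.domain ∩ win e (k + 1 + 1) ↔
      x ∈ r'.domain ∩ win e (k + 1) ∧ t ∈ Icc (a x) (b x) := by
    intro x t
    rw [hdom]
    simp only [mem_inter_iff, mem_setOf_eq, Fin.init_snoc, Fin.snoc_last, mem_Icc, mem_win_succ,
      snoc_apply_zero]
    tauto
  set G : (Fin (k + 1 + 1) → ℝ) → ℝ := (r.domain ∩ win e (k + 1 + 1)).indicator r.integrand
    with hG_def
  have hG : Integrable G :=
    (integrable_indicator_iff (hbm.inter hW2)).mpr (r.integrableOn.mono_set inter_subset_left)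
  have hfib_in : ∀ x ∈ r'.domain ∩ win e (k + 1), (fun t => G (Fin.snoc x t)) =
      (Icc (a x) (b x)).indicator (fun t => r.integrand (Fin.snoc x t)) := by
    intro x hx
    ext t
    by_cases ht : t ∈ Icc (a x) (b x)
    · rw [Set.indicator_of_mem ht, hG_def, Set.indicator_of_mem ((hmem x t).2 ⟨hx, ht⟩)]
    · rw [Set.indicator_of_notMem ht, hG_def,
        Set.indicator_of_notMem (fun h => ht ((hmem x t).1 h).2)]
  have hfib_out : ∀ x ∉ r'.domain ∩ win e (k + 1), (fun t => G (Fin.snoc x t)) = fun _ => 0 := by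
    intro x hx
    ext t
    rw [hG_def, Set.indicator_of_notMem (fun h => hx ((hmem x t).1 h).1)]
  have hG2 : Integrable (fun p : ℝ × (Fin (k + 1) → ℝ) => G (Fin.snoc p.2 p.1))
      ((volume : Measure ℝ).prod (volume : Measure (Fin (k + 1) → ℝ))) := by
    have h := ((hE.symm E).integrable_comp_emb E.symm.measurableEmbedding (g := G)).mpr hG
    rw [← Measure.volume_eq_prod]
    convert h using 1
    ext p
    simp [hE_symm]
  calc ∫ z in r.domain ∩ win e (k + 1 + 1), r.integrand z
      = ∫ z, G z := (integral_indicator (hbm.inter hW2)).symm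
    _ = ∫ p, G (E.symm p) := ((hE.symm E).integral_comp' G).symm
    _ = ∫ p : ℝ × (Fin (k + 1) → ℝ), G (Fin.snoc p.2 p.1) ∂(volume.prod volume) := by
        simp_rw [hE_symm, Measure.volume_eq_prod]
    _ = ∫ x, ∫ t, G (Fin.snoc x t) := integral_prod_symm _ hG2
    _ = ∫ x, (r'.domain ∩ win e (k + 1)).indicator
          (fun x => F (Fin.snoc x (b x)) - F (Fin.snoc x (a x))) x := by
        apply integral_congr_ae
        filter_upwards [hG2.prod_left_ae] with x hx
        by_cases hxτ : x ∈ r'.domain ∩ win e (k + 1)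
        · rw [Set.indicator_of_mem hxτ, hfib_in x hxτ, integral_indicator measurableSet_Icc,
            integral_Icc_eq_integral_Ioc, ← intervalIntegral.integral_of_le (hab x hxτ.1)]
          apply intervalIntegral.integral_eq_sub_of_hasDerivAt_of_le (hab x hxτ.1) (hcont x hxτ.1)
            (hderiv x hxτ.1)
          rw [intervalIntegrable_iff_integrableOn_Icc_of_le (hab x hxτ.1)]
          have hx' : Integrable (fun t => G (Fin.snoc x t)) := hx
          rw [hfib_in x hxτ] at hx'
          exact (integrable_indicator_iff measurableSet_Icc).mp hx'
        · rw [Set.indicator_of_notMem hxτ, hfib_out x hxτ, integral_zero]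
    _ = ∫ x in r'.domain ∩ win e (k + 1), (F (Fin.snoc x (b x)) - F (Fin.snoc x (a x))) :=
        integral_indicator (hτm.inter hW1)
    _ = ∫ x in r'.domain ∩ win e (k + 1), r'.integrand x :=
        (setIntegral_congr_fun (hτm.inter hW1) fun x hx => hr' x hx.1).symm

/-! ### The `1 → 0` Newton–Leibniz defect is a clamped primitive, hence semialgebraic in `e` -/

/-- One-variable bookkeeping: integrating a derivative over `[a₀, b₀] ∩ (−∞, e)` gives the
primitive at the clamped point `max a₀ (min e b₀)`. -/
theorem setIntegral_clamp {a₀ b₀ : ℝ} (hab : a₀ ≤ b₀) {f g : ℝ → ℝ}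
    (hcont : ContinuousOn f (Icc a₀ b₀)) (hderiv : ∀ t ∈ Ioo a₀ b₀, HasDerivAt f (g t) t)
    (hint : IntegrableOn g (Icc a₀ b₀)) (e : ℝ) :
    ∫ t in {t | a₀ ≤ t ∧ t ≤ b₀ ∧ t < e}, g t = f (max a₀ (min e b₀)) - f a₀ := by
  rcases le_or_gt e a₀ with hea | hea
  · -- empty range
    have hset : {t | a₀ ≤ t ∧ t ≤ b₀ ∧ t < e} = ∅ := by
      ext t
      simp only [mem_setOf_eq, mem_empty_iff_false, iff_false, not_and, not_lt]
      intro h1 _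
      exact hea.trans h1
    have hc : max a₀ (min e b₀) = a₀ := max_eq_left ((min_le_left e b₀).trans hea)
    rw [hset, Measure.restrict_empty, integral_zero_measure, hc, sub_self]
  · set c := min e b₀ with hc_def
    have hac : a₀ ≤ c := le_min hea.le hab
    have hcb : c ≤ b₀ := min_le_right e b₀
    have hmax : max a₀ (min e b₀) = c := max_eq_right hac
    rw [hmax]
    -- FTC on `[a₀, c]`
    have hftc : ∫ t in a₀..c, g t = f c - f a₀ := by
      apply intervalIntegral.integral_eq_sub_of_hasDerivAt_of_le hac
        (hcont.mono (Icc_subset_Icc_right hcb))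
        (fun t ht => hderiv t ⟨ht.1, ht.2.trans_le hcb⟩)
      rw [intervalIntegrable_iff_integrableOn_Icc_of_le hac]
      exact hint.mono_set (Icc_subset_Icc_right hcb)
    rw [← hftc, intervalIntegral.integral_of_le hac]
    rcases lt_or_ge b₀ e with hbe | hbe
    · -- the whole band: `{…} = Icc a₀ b₀`, `c = b₀`
      have hcb' : c = b₀ := min_eq_right hbe.le
      have hset : {t | a₀ ≤ t ∧ t ≤ b₀ ∧ t < e} = Icc a₀ b₀ := by
        ext t
        simp only [mem_setOf_eq, mem_Icc]
        exact ⟨fun h => ⟨h.1, h.2.1⟩, fun h => ⟨h.1, h.2, h.2.trans_lt hbe⟩⟩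
      rw [hset, hcb', integral_Icc_eq_integral_Ioc]
    · -- `c = e ≤ b₀`: `{…} = Ico a₀ e`
      have hce : c = e := min_eq_left hbe
      have hset : {t | a₀ ≤ t ∧ t ≤ b₀ ∧ t < e} = Ico a₀ e := by
        ext t
        simp only [mem_setOf_eq, mem_Ico]
        exact ⟨fun h => ⟨h.1, h.2.2⟩, fun h => ⟨h.1, h.2.le.trans hbe, h.2⟩⟩
      rw [hset, hce, integral_Ico_eq_integral_Ioc]

/-- The value of a `ℚ`-semialgebraic function on the point `ℝ⁰` is `ℚ`-definable:
`{y : ℝ¹ | y 0 = a x₀}` is `ℚ`-semialgebraic. -/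
theorem isSemialgebraic_setOf_apply_eq_of_fin_zero {τ : Set (Fin 0 → ℝ)} {a : (Fin 0 → ℝ) → ℝ}
    (ha : IsSemialgebraicFunOn ℚ τ a) {x₀ : Fin 0 → ℝ} (hx₀ : x₀ ∈ τ) :
    IsSemialgebraic ℚ {y : Fin 1 → ℝ | y 0 = a x₀} := by
  rw [isSemialgebraicFunOn_iff] at ha
  convert ha using 1
  ext y
  simp only [mem_setOf_eq]
  have h1 : (Fin.init y : Fin 0 → ℝ) = x₀ := Subsingleton.elim _ _
  have h2 : (Fin.last 0 : Fin (0 + 1)) = 0 := rfl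
  rw [h1, h2]
  exact ⟨fun h => ⟨hx₀, h⟩, fun h => h.2⟩

/-- `{y | y 0 ≤ c}` is `ℚ`-semialgebraic as soon as `{y | y 0 = c}` is (projection of
`{u | u 1 = c ∧ u 0 ≤ u 1}`: Tarski–Seidenberg). Formerly a theorem of this file (a duplicate, gate
dedup 2026-08-16); the name is kept (append-only) as a deprecated alias of the landed copy
`OffTetraSectorKernelNegative.isSemialgebraic_setOf_le_of_eq`, same statement. [folklore] -/
@[deprecated Summit.KontsevichZagierPeriods.HyperbolicBloch.OffTetraSectorKernelNegative.isSemialgebraic_setOf_le_of_eq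
  (since := "2026-08-16")]
alias isSemialgebraic_setOf_apply_le_of_eq :=
  Summit.KontsevichZagierPeriods.HyperbolicBloch.OffTetraSectorKernelNegative.isSemialgebraic_setOf_le_of_eq

/-- `{y | y 0 < c}` is `ℚ`-semialgebraic as soon as `{y | y 0 = c}` is. Formerly a theorem of this
file (a duplicate, gate dedup 2026-08-16); the name is kept (append-only) as a deprecated alias of the
landed copy `PlanarCompilerProof.isSemialgebraic_Iio_of_point`, same statement. [folklore] -/
@[deprecated Summit.KontsevichZagierPeriods.SymplecticScissors.PlanarCompilerProof.isSemialgebraic_Iio_of_point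
  (since := "2026-08-16")]
alias isSemialgebraic_setOf_apply_lt_of_eq :=
  Summit.KontsevichZagierPeriods.SymplecticScissors.PlanarCompilerProof.isSemialgebraic_Iio_of_point

/-- The clamp `e ↦ max a₀ (min e b₀)` is a `ℚ`-semialgebraic function of `e` when `a₀ ≤ b₀` are
`ℚ`-definable. -/
theorem isSemialgebraicFunOn_clamp {a₀ b₀ : ℝ} (hab : a₀ ≤ b₀)
    (ha : IsSemialgebraic ℚ {y : Fin 1 → ℝ | y 0 = a₀})
    (hb : IsSemialgebraic ℚ {y : Fin 1 → ℝ | y 0 = b₀}) :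
    IsSemialgebraicFunOn ℚ (univ : Set (Fin 1 → ℝ)) (fun z => max a₀ (min (z 0) b₀)) := by
  rw [isSemialgebraicFunOn_iff]
  -- pull the one-variable pieces back to `ℝ²` along `w ↦ w 0` and `w ↦ w 1`
  have p0 : ∀ {s : Set (Fin 1 → ℝ)}, IsSemialgebraic ℚ s →
      IsSemialgebraic ℚ {w : Fin (1 + 1) → ℝ | (fun _ : Fin 1 => w 0) ∈ s} :=
    fun hs => hs.preimage_comp (fun _ : Fin 1 => (0 : Fin (1 + 1)))
  have p1 : ∀ {s : Set (Fin 1 → ℝ)}, IsSemialgebraic ℚ s →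
      IsSemialgebraic ℚ {w : Fin (1 + 1) → ℝ | (fun _ : Fin 1 => w 1) ∈ s} :=
    fun hs => hs.preimage_comp (fun _ : Fin 1 => (1 : Fin (1 + 1)))
  have hle_a := Summit.KontsevichZagierPeriods.HyperbolicBloch.OffTetraSectorKernelNegative.isSemialgebraic_setOf_le_of_eq ha   -- {y | y 0 ≤ a₀}
  have hlt_b := Summit.KontsevichZagierPeriods.SymplecticScissors.PlanarCompilerProof.isSemialgebraic_Iio_of_point hb   -- {y | y 0 < b₀}
  have hdiag : IsSemialgebraic ℚ {w : Fin (1 + 1) → ℝ |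
      aeval w (X 1 : MvPolynomial (Fin (1 + 1)) ℚ) = aeval w (X 0 : MvPolynomial (Fin (1 + 1)) ℚ)} := by
    have := isSemialgebraic_setOf_eval_eq_zero (k := ℚ) (R := ℝ) (ι := Fin (1 + 1)) (X 1 - X 0)
    convert this using 2 with w
    simp [sub_eq_zero]
  have hS : IsSemialgebraic ℚ
      (({w : Fin (1 + 1) → ℝ | (fun _ : Fin 1 => w 0) ∈ {y : Fin 1 → ℝ | y 0 ≤ a₀}} ∩
        {w : Fin (1 + 1) → ℝ | (fun _ : Fin 1 => w 1) ∈ {y : Fin 1 → ℝ | y 0 = a₀}}) ∪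
      (({w : Fin (1 + 1) → ℝ | (fun _ : Fin 1 => w 0) ∈ {y : Fin 1 → ℝ | y 0 ≤ a₀}}ᶜ ∩
        {w : Fin (1 + 1) → ℝ | (fun _ : Fin 1 => w 0) ∈ {y : Fin 1 → ℝ | y 0 < b₀}}) ∩
        {w : Fin (1 + 1) → ℝ | aeval w (X 1 : MvPolynomial (Fin (1 + 1)) ℚ) = aeval w (X 0 : MvPolynomial (Fin (1 + 1)) ℚ)}) ∪
      ({w : Fin (1 + 1) → ℝ | (fun _ : Fin 1 => w 0) ∈ {y : Fin 1 → ℝ | y 0 < b₀}}ᶜ ∩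
        {w : Fin (1 + 1) → ℝ | (fun _ : Fin 1 => w 1) ∈ {y : Fin 1 → ℝ | y 0 = b₀}})) :=
    (((p0 hle_a).inter (p1 ha)).union (((p0 hle_a).compl.inter (p0 hlt_b)).inter hdiag)).union
      ((p0 hlt_b).compl.inter (p1 hb))
  convert hS using 1
  ext w
  simp only [mem_setOf_eq, mem_univ, true_and, mem_union, mem_inter_iff, mem_compl_iff, not_le,
    not_lt, MvPolynomial.aeval_X]
  have h0 : (Fin.init w : Fin 1 → ℝ) 0 = w 0 := rfl
  have hl : (Fin.last 1 : Fin (1 + 1)) = 1 := rfl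
  rw [h0, hl]
  constructor
  · intro hw
    rcases le_or_gt (w 0) a₀ with h1 | h1
    · left; left
      refine ⟨h1, ?_⟩
      rw [hw, min_eq_left (h1.trans hab), max_eq_left h1]
    · rcases lt_or_ge (w 0) b₀ with h2 | h2
      · left; right
        refine ⟨⟨h1, h2⟩, ?_⟩
        rw [hw, min_eq_left h2.le, max_eq_right h1.le]
      · right
        refine ⟨h2, ?_⟩
        rw [hw, min_eq_right h2, max_eq_right hab]
  · rintro ((⟨h1, h2⟩ | ⟨⟨h1, h2⟩, h3⟩) | ⟨h1, h2⟩)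
    · rw [h2, min_eq_left (h1.trans hab), max_eq_left h1]
    · rw [h3, min_eq_left h2.le, max_eq_right h1.le]
    · rw [h2, min_eq_right h1, max_eq_right hab]

end Summit.KontsevichZagierPeriods.PlanarAreas.Negative

end
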